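import Summits.Ventures.AbcSig.Rows.XTemplateAB2
import Summits.Ventures.AbcSig.Levels.N2432
import Summits.Ventures.AbcSig.Levels.N38

/-!
# Venture AbcSig — ROW `C2aL19A1V2AB`: `19^m·xⁿ + 2·yⁿ = z²`, class `a = 1`, over NORM-FORM level certificates (GENERATED by p-lean g4 `gen4/c2arow.py`)

HONEST FRAMING. A row of a COMPUTATION cell (`pub-abcsig`); a CONDITIONAL theorem, no claim on ABC or any summit.
Hypotheses: `BS04Package` (CITED: [BS04] Lemma 3.3 + (3.1) + Lemma 4.2); `DataComplete` at the levels 128·19 = 2432 (ordinary tree certificates) and 2·19 = 38 (ordinary tree certificates);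
and the listed per-orbit exclusions `hX_…` (CITED: the row of record's module M8 'level-drop by congruence' closures, lead RULING M8 /
lit/M8-PIN.md, engine-2 + p1 second implementation + referee third reading — nothing of M8 is checked here).
Exponent range: prime `n ≥ 11`, `n ≠ 19`; `B = 2·19^m` with `1 ≤ m < n` (RULING H1 reduced exponents).
CITED (module M8 'level-drop by congruence', RULING PIN-FALLBACK + lit/M8-PIN.md countersign): the four orbits 2432.21–.24 at n = 11 (the printed exception of [BS04, Thm 1.3]); everything else is kernel-checked in the ORDINARY level files Levels/N2432.lean and Levels/N38.lean (no norm-form file needed here). v2 residual: none (v1: {11}, row_C2aL19A1).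
Row of record: `census/rows/T-BS13/C2a-l19-a1.md` (v2 = superseding revision; sha16 `924c604716b4fdbd`; v2 R8-signed 2026-08-23T01:59:29Z by referee (ref-g23); HEADLINE: [BS04, Thm 1.3] printed exception (19; 11; α = 1) REMOVED ⇒ Theorem B '8 of 11').
-/

namespace Summit.Ventures.AbcSig

/-- Row `C2aL19A1V2AB`: class `a = 1`, second distribution, prime `n ≥ 11`, `n ≠ 19`; conditional on the named hypotheses. -/
theorem xrow_C2aL19A1V2AB (M : NewformModel) (hP : M.BS04Package)
    (hD38 : M.DataComplete 38 level38Orbits)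
    (hD2432 : M.DataComplete 2432 level2432Orbits)
    (n : ℕ) (hn : n.Prime) (hmin : 11 ≤ n) (hnℓ : n ≠ 19) (m : ℕ) (hm : 1 ≤ m) (hmn : m < n)
    (hX_orbit_2432_21 : n ∈ ([11] : List ℕ) → M.Excludes 2432 orbit_2432_21
      (famAB (19 ^ m) (2 ^ 1) n (fun _ _ => True)))
    (hX_orbit_2432_22 : n ∈ ([11] : List ℕ) → M.Excludes 2432 orbit_2432_22
      (famAB (19 ^ m) (2 ^ 1) n (fun _ _ => True)))
    (hX_orbit_2432_23 : n ∈ ([11] : List ℕ) → M.Excludes 2432 orbit_2432_23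
      (famAB (19 ^ m) (2 ^ 1) n (fun _ _ => True)))
    (hX_orbit_2432_24 : n ∈ ([11] : List ℕ) → M.Excludes 2432 orbit_2432_24
      (famAB (19 ^ m) (2 ^ 1) n (fun _ _ => True)))
    (x y z : ℤ) (hxy1 : x * y ≠ 1) (hxy2 : x * y ≠ -1) : ¬ IsPrimitiveSolution (19 ^ m) (2 ^ 1) 1 n x y z := by
  have hℓ : Nat.Prime 19 := by norm_num
  have h7 : 7 ≤ n := by omega
  exact xrowC2aAB_a1 19 hℓ (by norm_num) M hP n hn h7 hnℓ hD2432 hD38 m hm hmn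
    (level2432_sieve n hn h7 (fun o => M.Excludes 2432 o
      (famAB (19 ^ m) (2 ^ 1) n (fun _ _ => True)) ∨ M.ExcludesStd 2432 o n) (fun hmem => by
      rcases (by simpa using hmem : n = 7 ∨ n = 11) with rfl | rfl
      · omega
      · exact Or.inl (hX_orbit_2432_21 (by simp))) (fun hmem => by
      rcases (by simpa using hmem : n = 7 ∨ n = 11) with rfl | rfl
      · omega
      · exact Or.inl (hX_orbit_2432_22 (by simp))) (fun hmem => by
      rcases (by simpa using hmem : n = 7 ∨ n = 11) with rfl | rfl
      · omega
      · exact Or.inl (hX_orbit_2432_23 (by simp))) (fun hmem => by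
      rcases (by simpa using hmem : n = 7 ∨ n = 11) with rfl | rfl
      · omega
      · exact Or.inl (hX_orbit_2432_24 (by simp))))
    (level38_sieve n hn h7 (fun o => M.Excludes 38 o
      (famAB (19 ^ m) (2 ^ 1) n (fun _ _ => True)) ∨ M.ExcludesStd 38 o n) )
    x y z hxy1 hxy2

end Summit.Ventures.AbcSig
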